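import Summits.Ventures.DiscreteObjects.Hadamard.ConferenceGraph333Order11CharacterTest
import Summits.Ventures.DiscreteObjects.Hadamard.ConferenceGraph333Orders33And88

/-!
# Order `33` in Aut(srg(333,166,82,83)): the unique cycle type `33⁸·11⁴·3⁸·1¹` (kernel, via the averaged rank test)

Framing: lottery ticket; floor = certified bounds/negative ranges.  Cell pub-namedobj (venture DiscreteObjects),
target (H) = `H(668)`, hadamard gen 32.  First census COROLLARY of the kernel instance of the averaged (character) partial-Hadamard rank test
(`ConferenceGraph333Order11CharacterTest.aut_order11_commuting_character_test`).  For `σ` of order `33` put `ρ = σ³` (order `11`, `25` fixed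
vertices, `28` orbits of size `11`).  For `3 ∣ j` the power `σʲ ∈ ⟨ρ⟩` fixes every orbit and every vertex of `Fix ρ` (summand `308 − 11·25 = 33`);
for `3 ∤ j` a `ρ`-moved vertex `x` has `σʲx ∈ ⟨ρ⟩x` iff `σ¹¹x = x` (the points of the `11`-cycles), and `Fix σʲ ∩ Fix ρ = Fix σ`, so the summand is
`(#Fix σ¹¹ − #Fix σ) − 11·#Fix σ`.  Hence `0 ≤ 11·33 + 22·(#Fix σ¹¹ − 12·#Fix σ)`, which kills the second type of `aut_order33_census`
(`#Fix σ = 7`, `#Fix σ¹¹ = 51`: `363 − 726 < 0`):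
* **`aut_order33_unique_type`** — `σ` of order `33` ⇒ `#Fix σ = 1`, `#Fix σ³ = 25`, `#Fix σ¹¹ = 45` (cycle type `33⁸·11⁴·3⁸·1¹`).
E2: pub-namedobj-hadamard-g31/results/rank_test_11_g31.txt (`n = 33`: 2 → 1; χ = (3, −3, −3, 3, …) has Σ = −33 for the killed type) and
verify-ref g184 (Σ = −33 / +99).  WORDS: structure of a HYPOTHETICAL object (order `33` remains admissible); ours (PROVISIONAL).
No `sorry`, no new definitions.
-/

namespace Summit.Ventures.DiscreteObjects.Hadamard

open Finset

section order33
variable {V : Type*} [Fintype V] [DecidableEq V]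

omit [Fintype V] [DecidableEq V] in
/-- coprime exponents: `σ^a x = x` and `σ^b x = x` with `a, b` coprime, `b > 1`, force `σ x = x` (private copy of the
`CompositeOrderTools` lemma, to keep the import list short). -/
private lemma perm_fixed_of_pow_coprime_o33 (σ : Equiv.Perm V) {a b : ℕ} (hab : Nat.Coprime a b) (hb : 1 < b)
    {x : V} (ha : (σ ^ a) x = x) (hbx : (σ ^ b) x = x) : σ x = x := by
  obtain ⟨m, -, hm⟩ := Nat.exists_mul_mod_eq_one_of_coprime hab hb
  have h1 : (σ ^ (a * m)) x = x := by rw [pow_mul]; exact Equiv.Perm.pow_apply_eq_self_of_apply_eq_self ha m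
  have h2 : (σ ^ (b * (a * m / b))) x = x := by
    rw [pow_mul]; exact Equiv.Perm.pow_apply_eq_self_of_apply_eq_self hbx _
  have e : a * m = b * (a * m / b) + 1 := by
    have := Nat.div_add_mod (a * m) b
    omega
  rw [e, pow_succ', Equiv.Perm.mul_apply, h2] at h1
  exact h1

/-- **Order `33`: the unique cycle type** — `#Fix σ = 1`, `#Fix σ³ = 25`, `#Fix σ¹¹ = 45`. -/
theorem aut_order33_unique_type (hV : Fintype.card V = 333) (A : Matrix V V ℤ)
    (h01 : ∀ x y, A x y = 0 ∨ A x y = 1) (hsymm : ∀ x y, A y x = A x y) (hdiag : ∀ x, A x x = 0)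
    (hk : ∀ x, ∑ y, A x y = 166) (hsrg : ∀ x y, ∑ z, A x z * A z y = 83 * (1 + (if x = y then 1 else 0)) - A x y)
    (σ : Equiv.Perm V) (hσ : σ ^ 33 = 1) (hσ11 : σ ^ 11 ≠ 1) (hσ3 : σ ^ 3 ≠ 1) (hA : ∀ x y, A (σ x) (σ y) = A x y) :
    (univ.filter fun x => σ x = x).card = 1 ∧ (univ.filter fun x => (σ ^ 3) x = x).card = 25 ∧
      (univ.filter fun x => (σ ^ 11) x = x).card = 45 := by
  have hAk := adj_pow_invariant A σ hA
  obtain ⟨h25, hcases⟩ := aut_order33_census hV A h01 hsymm hdiag hk hsrg σ hσ hσ11 hσ3 hA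
  -- ρ = σ³ has order 11 and commutes with σ
  have hρ : (σ ^ 3) ^ 11 = 1 := by rw [← pow_mul]; exact hσ
  have hcomm : σ * σ ^ 3 = σ ^ 3 * σ := by rw [← pow_succ', ← pow_succ]
  have hchar := aut_order11_commuting_character_test hV A h01 hsymm hdiag hk hsrg (σ ^ 3) hρ hσ3 (hAk 3) σ hcomm hA
    (by norm_num : 0 < 33) hσ
  -- counting facts
  have hmoved : (univ.filter fun x => (σ ^ 3) x ≠ x).card = 308 := by
    have h := Finset.card_filter_add_card_filter_not (s := (univ : Finset V)) (fun x => (σ ^ 3) x = x)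
    rw [Finset.card_univ, hV, h25] at h
    have : (univ.filter fun x => ¬ (σ ^ 3) x = x).card = 308 := by omega
    exact this
  have hfix2 : (univ.filter fun x => (σ ^ 11) x = x ∧ (σ ^ 3) x = x) = univ.filter fun x => σ x = x := by
    refine Finset.filter_congr fun x _ => ⟨fun h => perm_fixed_of_pow_coprime_o33 σ (by norm_num : Nat.Coprime 11 3)
      (by norm_num) h.1 h.2, fun h => ⟨Equiv.Perm.pow_apply_eq_self_of_apply_eq_self h 11,
        Equiv.Perm.pow_apply_eq_self_of_apply_eq_self h 3⟩⟩
  have hsplit := Finset.card_filter_add_card_filter_not (s := univ.filter fun x => (σ ^ 11) x = x) (fun x => (σ ^ 3) x = x)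
  rw [Finset.filter_filter, Finset.filter_filter, hfix2] at hsplit
  -- for 3 ∤ j: a ρ-moved x has σʲ x ∈ ⟨ρ⟩x iff σ¹¹ x = x
  have hkey : ∀ j, ¬ 3 ∣ j → ∀ x, (σ ^ 3) x ≠ x →
      ((σ ^ j) x ∈ (Finset.range 11).image (fun k => ((σ ^ 3) ^ k) x) ↔ (σ ^ 11) x = x) := by
    intro j hj x hx
    constructor
    · intro hmem
      obtain ⟨k, hk11, hkx⟩ := Finset.mem_image.mp hmem
      rw [Finset.mem_range] at hk11
      by_contra h11
      -- σ^(33 - 3k + j) fixes x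
      have hn : (σ ^ (33 - 3 * k + j)) x = x := by
        rw [pow_add, Equiv.Perm.mul_apply, ← hkx, ← pow_mul, ← Equiv.Perm.mul_apply, ← pow_add,
          Nat.sub_add_cancel (by omega : 3 * k ≤ 33), hσ, Equiv.Perm.one_apply]
      by_cases h11n : 11 ∣ 33 - 3 * k + j
      · obtain ⟨n', hn'⟩ := h11n
        have h1 : ((σ ^ 11) ^ n') x = x := by rw [← pow_mul, ← hn']; exact hn
        have h2 : ((σ ^ 11) ^ 3) x = x := by rw [← pow_mul, hσ, Equiv.Perm.one_apply]
        have hnd : ¬ 3 ∣ n' := by omega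
        have hcop : Nat.Coprime n' 3 := ((Nat.Prime.coprime_iff_not_dvd (by norm_num : Nat.Prime 3)).mpr hnd).symm
        exact h11 (perm_fixed_of_pow_coprime_o33 (σ ^ 11) hcop (by norm_num) h1 h2)
      · have hc3 : Nat.Coprime (33 - 3 * k + j) 3 :=
          ((Nat.Prime.coprime_iff_not_dvd (by norm_num : Nat.Prime 3)).mpr (by omega)).symm
        have hc11 : Nat.Coprime (33 - 3 * k + j) 11 :=
          ((Nat.Prime.coprime_iff_not_dvd (by norm_num : Nat.Prime 11)).mpr h11n).symm
        have hcop : Nat.Coprime (33 - 3 * k + j) 33 := Nat.Coprime.mul_right hc3 hc11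
        have hfix : σ x = x :=
          perm_fixed_of_pow_coprime_o33 σ hcop (by norm_num) hn (by rw [hσ, Equiv.Perm.one_apply])
        exact hx (Equiv.Perm.pow_apply_eq_self_of_apply_eq_self hfix 3)
    · intro h11
      have hdvd : 3 ∣ j + 11 * (j % 3) := by omega
      obtain ⟨K, hK⟩ := hdvd
      refine Finset.mem_image.mpr ⟨K % 11, Finset.mem_range.mpr (Nat.mod_lt _ (by norm_num)), ?_⟩
      show ((σ ^ 3) ^ (K % 11)) x = (σ ^ j) x
      rw [← perm_pow_apply_mod (σ ^ 3) hρ, ← pow_mul, ← hK, pow_add, Equiv.Perm.mul_apply, pow_mul,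
        Equiv.Perm.pow_apply_eq_self_of_apply_eq_self h11]
  -- the summands
  have hterm : ∀ j ∈ Finset.range 33,
      (((univ.filter fun x => (σ ^ 3) x ≠ x ∧ (σ ^ j) x ∈ (Finset.range 11).image (fun k => ((σ ^ 3) ^ k) x)).card : ℤ)
        - 11 * ((univ.filter fun x => (σ ^ j) x = x ∧ (σ ^ 3) x = x).card : ℤ))
      = if 3 ∣ j then (33 : ℤ) else
          ((univ.filter fun x => (σ ^ 11) x = x ∧ ¬ (σ ^ 3) x = x).card : ℤ) - 11 * ((univ.filter fun x => σ x = x).card : ℤ) := by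
    intro j _
    by_cases h3 : 3 ∣ j
    · rw [if_pos h3]
      obtain ⟨m, rfl⟩ := h3
      have e1 : (univ.filter fun x => (σ ^ 3) x ≠ x ∧ (σ ^ (3 * m)) x ∈ (Finset.range 11).image (fun k => ((σ ^ 3) ^ k) x))
          = univ.filter fun x => (σ ^ 3) x ≠ x := by
        refine Finset.filter_congr fun x _ => ⟨fun h => h.1, fun h => ⟨h, ?_⟩⟩
        refine Finset.mem_image.mpr ⟨m % 11, Finset.mem_range.mpr (Nat.mod_lt _ (by norm_num)), ?_⟩
        show ((σ ^ 3) ^ (m % 11)) x = (σ ^ (3 * m)) x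
        rw [← perm_pow_apply_mod (σ ^ 3) hρ, ← pow_mul]
      have e2 : (univ.filter fun x => (σ ^ (3 * m)) x = x ∧ (σ ^ 3) x = x) = univ.filter fun x => (σ ^ 3) x = x := by
        refine Finset.filter_congr fun x _ => ⟨fun h => h.2, fun h => ⟨?_, h⟩⟩
        rw [pow_mul]; exact Equiv.Perm.pow_apply_eq_self_of_apply_eq_self h m
      rw [e1, e2, hmoved, h25]; norm_num
    · rw [if_neg h3]
      have hcop3 : Nat.Coprime j 3 := ((Nat.Prime.coprime_iff_not_dvd (by norm_num : Nat.Prime 3)).mpr h3).symm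
      have e1 : (univ.filter fun x => (σ ^ 3) x ≠ x ∧ (σ ^ j) x ∈ (Finset.range 11).image (fun k => ((σ ^ 3) ^ k) x))
          = univ.filter fun x => (σ ^ 11) x = x ∧ ¬ (σ ^ 3) x = x := by
        refine Finset.filter_congr fun x _ => ⟨fun h => ⟨(hkey j h3 x h.1).mp h.2, h.1⟩, fun h => ⟨h.2, (hkey j h3 x h.2).mpr h.1⟩⟩
      have e2 : (univ.filter fun x => (σ ^ j) x = x ∧ (σ ^ 3) x = x) = univ.filter fun x => σ x = x := by
        refine Finset.filter_congr fun x _ => ⟨fun h => perm_fixed_of_pow_coprime_o33 σ hcop3 (by norm_num) h.1 h.2,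
          fun h => ⟨Equiv.Perm.pow_apply_eq_self_of_apply_eq_self h j, Equiv.Perm.pow_apply_eq_self_of_apply_eq_self h 3⟩⟩
      rw [e1, e2]
  rw [Finset.sum_congr rfl hterm, Finset.sum_ite, Finset.sum_const, Finset.sum_const] at hchar
  have hc3 : ((Finset.range 33).filter (fun j => 3 ∣ j)).card = 11 := by decide
  have hn3 : ((Finset.range 33).filter (fun j => ¬ 3 ∣ j)).card = 22 := by decide
  rw [hc3, hn3, nsmul_eq_mul, nsmul_eq_mul] at hchar
  rcases hcases with ⟨h1, h45⟩ | ⟨h7, h51⟩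
  · exact ⟨h1, h25, h45⟩
  · exfalso
    rw [h7, h51] at hsplit
    rw [h7] at hchar
    simp only [Nat.cast_ofNat] at hchar
    omega

end order33

end Summit.Ventures.DiscreteObjects.Hadamard
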